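import Literature.Barriers.CriticalPhenomena.WeaklySAWFourDimLogCorrectionsChangeOfParameters
import Literature.Barriers.CriticalPhenomena.WeaklySAWFourDimLogCorrectionsLemma21
import Literature.Barriers.CriticalPhenomena.WeaklySAWFourDimLogCorrectionsBubble
import HarnessLib

/-!
# `WeaklySAWFourDimLogCorrections` (BBS 2015, Theorem 1.1): assembly of the proved layers

Bauerschmidt–Brydges–Slade, CMP 337 (2015), arXiv:1403.7422. The reduction
`BBS2015_thm11_of_thm41` (`…Reduction.lean`) proves Theorem 1.1 (`CTWSAW.BBS2015_thm11`, the
barrier `WeaklySAWFourDimLogCorrections`) from four named facts; three of them are now discharged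
in the tree — Proposition 4.2(ii) relative to Lemma A.1 (`BBS2015_prop42ii_of_lemA1`,
`…ChangeOfParameters.lean`), the used part of Lemma 2.1 (`BBS2015_lem21_holds`, `…Lemma21.lean`)
and the bubble asymptotics (1.8) (`BBS2015_eq18_holds`, `…Bubble.lean`). This file records the
resulting implication: **Theorem 1.1 follows from Theorem 4.1 (the renormalisation-group theorem,
`BBS2015_thm41`) and Lemma A.1 (`BBS2015_lemA1`)**, both named facts of the source about the
objects of the barrier file; Theorem 4.1 is the output of the renormalisation-group analysis of
§5–§8 and the companion papers and is not formalised.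
-/

namespace Literature.Barriers.CriticalPhenomena

namespace CTWSAW

/-- **Theorem 1.1 from Theorem 4.1 and Lemma A.1** (all other inputs of the printed proof —
Proposition 4.2, Lemma 4.3, the used part of Lemma 2.1, (1.8) — being proved in the tree).
[cite: BauerschmidtBrydgesSlade2015LogCorr, Theorem 1.1, §4.2–§4.3] -/
theorem BBS2015_thm11_of_thm41_lemA1 (h41 : BBS2015_thm41) (hA : BBS2015_lemA1) : BBS2015_thm11 :=
  BBS2015_thm11_of_thm41 h41 (BBS2015_prop42ii_of_lemA1 hA) BBS2015_lem21_holds BBS2015_eq18_holds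

end CTWSAW

/-- The barrier `WeaklySAWFourDimLogCorrections` from Theorem 4.1 and Lemma A.1 of the source.
[cite: BauerschmidtBrydgesSlade2015LogCorr, Theorem 1.1, §4.2–§4.3] -/
theorem weaklySAWFourDimLogCorrections_of_thm41_lemA1 (h41 : CTWSAW.BBS2015_thm41)
    (hA : CTWSAW.BBS2015_lemA1) : WeaklySAWFourDimLogCorrections :=
  CTWSAW.BBS2015_thm11_of_thm41_lemA1 h41 hA

end Literature.Barriers.CriticalPhenomena
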